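import Summits.BirchSwinnertonDyer.Rank1Residual.O5.O5KummerLine
import HarnessLib

/-!
# T33 — the local point lattice of an O5b curve along `ℚ₃(μ_{3^∞})`: the combinatorics (PROVED), the lattice
# interface D-T33-1 and the laws L1–L4, L7 as EVIDENCE-labelled nodes (typed for cc-typer-5, ask A-O5-33)
(cell `b2b-bsdres`, lane CLASS-CLOSURE, team o5, planner o5-r1 GEN 16; memo
 `HOME/b2b-bsdres-o5-r1/gen16/T33-LOCAL-POINT-LATTICE.md` §1–§5, kit j145657, prereg `gen16/t33/PREREG-T33.md`;
 typer of record cc-typer-5 GEN 11. NOTHING about curves is asserted; no Literature fact is introduced.)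

HONEST FRAMING (cell `b2b-bsdres`, verbatim in every file): the goal of the cell is to DELETE the COMBINATION-SHAPED
residual classes of the Birch–Swinnerton-Dyer formula for ALL analytic-rank `≤ 1` elliptic curves over `ℚ` — "full BSD
formula for every rank `≤ 1` curve in class `C`" assembled STRICTLY from published theorems — so that the rank-`≤ 1`
remainder becomes exactly the CONSTRUCTION-SHAPED classes, which are TYPED (missing-input `Prop`s), NOT attempted.
Lane CLASS-CLOSURE: census output is EVIDENCE / conjecture items with held-out validation, never a Literature fact.

WHAT THIS FILE TYPES.
* §1 (planner's shell, identities now GENERAL): the half-cyclotomic degree sums `Q⁺(n) = Σ_{0 ≤ k < n, k ≡ n (2)} φ(3^k)`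
  (`φ(1) = 1`) and `Q⁻(n) = Σ_{1 ≤ k < n, k ≡ n (2)} φ(3^k)`, the two-step recursion, the CLOSED FORMS
  `4Q⁺(m) = 3^{m−1} + (−1)^m`, `4Q⁻(m) + 2 = 3^{m−1} − (−1)^m` and the identification with the tree's `kuriharaQ`
  (`Q⁻(n) = kuriharaQ (n−1)`, `Q⁺(n) = kuriharaQ (n−1) + [n even]`) for EVERY `n ≥ 1` (the draft had `n ≤ 8` by `decide`):
  T33's prediction table and T9's growth template (`O5/O5GrowthLaws.lean`) are provably the same numbers. `twistShift` = the
  normalisation vector `T(m, ε)` of laws L3/L7.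
* §2 D-T33-1 as an INTERFACE `LocalLatticeDatum W` (position invariants `posCap n m ε`, `posPr n m ε` of the `ℤ₃[G_n]`-lattice
  `L_n(W) := log_ω(W(k_n) ⊗ ℤ₃) ⊂ k_n = ℚ₃(μ_{3^{n+1}})`, memo §1) with a realisation predicate `realL` carried as a section
  variable — exactly the pattern of `O6.LocalTowerDatum` / `O5Targets.SignedIwasawaData`. WHY NOT A CONSTRUCTED `def`
  (the typer's answer to A-O5-33 (ii)): the subject needs (a) the formal-group logarithm of `W/ℚ₃` as a CONVERGENT function on
  `𝔪_{k_n}` — the tree has `formalLog` only as a formal power series over `ℚ`-algebras (`Literature/…/FormalGroup.lean`), no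
  evaluation / convergence API and no formal group law over `ℤ₃`; (b) a normed-field structure on `CyclotomicField (3^(n+1)) ℚ_[3]`
  (Mathlib: none registered); (c) the identification `W₁(k_n) ≅ Ŵ(𝔪_{k_n})` and the extension of `log_ω` to `W(k_n) ⊗ ℤ₃`.
  Each is prover-sized; none exists. So D1-fin's MODULE-THEORETIC clauses (generators `x_n, x_{n−1}`, `Tr_{n/n−1} x_n = −x_{n−2}`)
  stay a docstring conjecture keyed to the engine (`gen16/t33/loclat.py`), as the planner allowed, and only their POSITION
  content is typed (memo §5: "(a)–(c) ⇒ L1, L3, L4 for all n, and conversely L1+L3+L4 at level n are (a)–(c) at level n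
  component-wise").
* §3 the laws as `@[conjecture]` EVIDENCE nodes over `realL`: L1 `SignedCapLawThree` (irr), L2 `BoundedCapLawThree` (reducible:
  split / nonsplit), L3 `TopProjectionLawThree` (class-blind), L4 `SkipLevelLawThree` (irr), L7 `LatticeTwistTransportLawThree`
  (irr O5b vs ANY good supersingular curve: a COMPARISON statement), and the position form of D1-fin `DOneFinPositionLawThree`
  with the PROVED bookkeeping `dOneFinPositionLaw_of_laws` (L1+L3+L4 ⇒ D1-fin-pos), the closed profiles `irrCapProfile` /
  `irrPrProfile` it forces (`posCap_eq_irrCapProfile`, `posPr_eq_irrPrProfile`), the record that these closed profiles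
  REPRODUCE the memo's exact `n ≤ 4` table of the reference row `3150f1` (`irrProfile_matches_table`, `decide`), and
  `posCap_eq_of_twistTransport` (L7 ⇒ the irr profile is class-constant = prereg P1 on the irr class).
EVIDENCE (memo §3, §3′; seat prototype, exact 3-adic arithmetic): L1/L3/L4/L7 exact for `n ≤ 4` on `3150f1` and class-constant on
~10 prototype rows (`n ≤ 3`); the pre-registered fork 'linear −3 vs signed −7/−6 at n = 4' decided for SIGNED; L7's ten `n = 4`
components were predicted from `n = 3` and all hit; all-rows / `n = 5` = P1–P3 of kit j145657 (result: TARGETS §O5 (G16-8)).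
Falsifier of each node: one realised row violating the displayed equation.
References: [Kobayashi2003] §8; [Pollack2003] (`ω̃^±`, `q_n`); [Kurihara2002]; [Kato2004] Thm 12.5; [LeiPollackPratap2024]
arXiv:2412.16629 §4.3 [corpus: paper-arxiv-2412.16629 p0015]; [Delbourgo1998] p.152 [corpus: delbourgo1998 p0030];
[KKS2018] arXiv:1808.07726 §2 Thm 2.1 / Cor 2.4 (unramified base only; excludes the split class) [corpus: paper-arxiv-1808.07726
p0005–p0007]. Presearch (planner §6 + typer): no corpus/galaxy hit for a signed / ± lattice law over the RAMIFIED cyclotomic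
tower at an additive prime ("signed Coleman|plus/minus Selmer|ramified"): D1-fin / L1–L4 NOT IN PRINT as far as searched.
-/

set_option autoImplicit false

open WeierstrassCurve Literature.NumberTheory.EllipticCurves Summit.BirchSwinnertonDyer.Rank1Residual.Additive

namespace Summit.BirchSwinnertonDyer.Rank1Residual.O5

/-! ## §1 The combinatorics (planner's shell; identities general) -/

/-- `φ(3^k)` in closed form, with the T33 convention `φ(3^0) = φ(1) = 1` (the trivial character's level counts one step). -/
def totientThreePow (k : ℕ) : ℕ := if k = 0 then 1 else 2 * 3 ^ (k - 1)

/-- `totientThreePow k = φ(3^k)` (Mathlib's `Nat.totient`). -/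
theorem totientThreePow_eq_totient (k : ℕ) : totientThreePow k = Nat.totient (3 ^ k) := by
  unfold totientThreePow
  rcases Nat.eq_zero_or_pos k with hk | hk
  · subst hk; simp
  · rw [if_neg (by omega), Nat.totient_prime_pow Nat.prime_three hk]
    ring

/-- `Q⁺(n) = Σ_{0 ≤ k < n, k ≡ n (mod 2)} φ(3^k)`: the cost, in `(γ−1)`-steps at level `n`, of killing the lower character levels
of the parity class of `n` INCLUDING the bottom level — the T33 position law for the `σ₋₁`-even top component on `LocIrr` rows
(memo §3 L1; Kobayashi's / Pollack's half products `ω̃^±`). -/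
def kobQplus (n : ℕ) : ℕ :=
  ∑ k ∈ (Finset.range n).filter (fun k => k % 2 = n % 2), totientThreePow k

/-- `Q⁻(n) = Σ_{1 ≤ k < n, k ≡ n (mod 2)} φ(3^k)`: the same without the bottom level — the law for the `σ₋₁`-odd top component. -/
def kobQminus (n : ℕ) : ℕ :=
  ∑ k ∈ (Finset.range n).filter (fun k => k % 2 = n % 2 ∧ 1 ≤ k), totientThreePow k

/-- The T33 prediction constants (memo §3, prereg P3: `n = 5` gives `20 / 20`, top projections `−40 / −41`). -/
theorem kobQ_values :
    kobQplus 1 = 0 ∧ kobQplus 2 = 1 ∧ kobQplus 3 = 2 ∧ kobQplus 4 = 7 ∧ kobQplus 5 = 20 ∧ kobQplus 6 = 61 ∧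
    kobQminus 1 = 0 ∧ kobQminus 2 = 0 ∧ kobQminus 3 = 2 ∧ kobQminus 4 = 6 ∧ kobQminus 5 = 20 ∧ kobQminus 6 = 60 := by
  decide

/-- Two-step recursion: passing from level `n` to `n + 2` adds the level-`n` character step `φ(3^n)`. -/
theorem kobQplus_add_two (n : ℕ) : kobQplus (n + 2) = kobQplus n + totientThreePow n := by
  unfold kobQplus
  rw [Finset.sum_filter, Finset.sum_filter, Finset.sum_range_succ, Finset.sum_range_succ]
  have h1 : (n + 2) % 2 = n % 2 := by omega
  have h2 : (n + 1) % 2 ≠ n % 2 := by omega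
  simp [h1, h2]

/-- The same recursion for `Q⁻` (`n ≥ 1`; `Q⁻(2) = Q⁻(0) = 0` is the exception). -/
theorem kobQminus_add_two (n : ℕ) (hn : 1 ≤ n) : kobQminus (n + 2) = kobQminus n + totientThreePow n := by
  unfold kobQminus
  rw [Finset.sum_filter, Finset.sum_filter, Finset.sum_range_succ, Finset.sum_range_succ]
  have h1 : (n + 2) % 2 = n % 2 := by omega
  have h2 : (n + 1) % 2 ≠ n % 2 := by omega
  simp [h1, h2, hn]

/-- CLOSED FORM (every `m ≥ 1`; planner's draft: `m ≤ 10` by `decide`, found by the Kobayashi calibration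
`gen16/t33/koba_calib.py`): `4·Q⁺(m) = 3^{m−1} + (−1)^m` and `4·Q⁻(m) + 2 = 3^{m−1} − (−1)^m`, i.e. the top positions
`−2Q⁺(m)` / `−2Q⁻(m) − 1` are `−(3^{m−1} ± (−1)^m)/2` = the valuation `−1/4 = v₃(λ⁻¹)` of the twist `ω_W = λ⁻¹ω_A` ROUNDED to
the step lattice `(1/φ(3^m))ℤ` with parity `±(−1)^m` (memo §3′: the top law is the twist normalisation, hence class-blind). -/
theorem kobQ_closed_form (m : ℕ) (hm : 1 ≤ m) :
    (4 * (kobQplus m : ℤ) = 3 ^ (m - 1) + (-1) ^ m) ∧ (4 * (kobQminus m : ℤ) + 2 = 3 ^ (m - 1) - (-1) ^ m) := by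
  obtain ⟨j, rfl⟩ : ∃ j, m = j + 1 := ⟨m - 1, by omega⟩
  clear hm
  simp only [Nat.add_sub_cancel]
  induction j using Nat.twoStepInduction with
  | zero => decide
  | one => decide
  | more j ih _ =>
    have hp := kobQplus_add_two (j + 1)
    have hm := kobQminus_add_two (j + 1) (by omega)
    have ht : (totientThreePow (j + 1) : ℤ) = 2 * 3 ^ j := by simp [totientThreePow]
    refine ⟨?_, ?_⟩
    · rw [show j + 2 + 1 = j + 1 + 2 from rfl, hp]; push_cast; rw [ht, pow_succ, pow_succ, pow_succ, pow_succ]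
      linear_combination ih.1
    · rw [show j + 2 + 1 = j + 1 + 2 from rfl, hm]; push_cast; rw [ht, pow_succ, pow_succ, pow_succ, pow_succ]
      linear_combination ih.2

/-- `3^j mod 4` alternates `1, 3`. -/
theorem three_pow_mod_four (j : ℕ) : 3 ^ j % 4 = if j % 2 = 0 then 1 else 3 := by
  induction j with
  | zero => rfl
  | succ j ih =>
    rw [pow_succ, Nat.mul_mod, ih]
    by_cases h : j % 2 = 0
    · rw [if_pos h, if_neg (by omega)]
    · rw [if_neg h, if_pos (by omega)]

/-- `4 · kuriharaQ j + (1 resp. 3) = 3^j` for `j` even resp. odd: the tree's closed form has no rounding loss. -/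
theorem four_mul_kuriharaQ_add (j : ℕ) : 4 * kuriharaQ j + (if j % 2 = 0 then 1 else 3) = 3 ^ j := by
  have h := three_pow_mod_four j
  have h2 := Nat.div_add_mod (3 ^ j) 4
  unfold kuriharaQ
  split_ifs at h ⊢ with hj <;> omega

/-- T33's odd-component law and T9's growth template are the SAME sequence with the SAME index shift:
`Q⁻(n) = kuriharaQ (n − 1)` for every `n ≥ 1` (planner's draft: `n ≤ 8` by `decide`; general here). -/
theorem kobQminus_eq_kuriharaQ_pred (n : ℕ) (hn : 1 ≤ n) : kobQminus n = kuriharaQ (n - 1) := by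
  obtain ⟨j, rfl⟩ : ∃ j, n = j + 1 := ⟨n - 1, by omega⟩
  have hc := (kobQ_closed_form (j + 1) (by omega)).2
  have hk := four_mul_kuriharaQ_add j
  simp only [Nat.add_sub_cancel] at hc ⊢
  rcases Nat.even_or_odd j with ⟨i, hi⟩ | ⟨i, hi⟩
  · have hj : j % 2 = 0 := by omega
    rw [if_pos hj] at hk
    have h1 : (-1 : ℤ) ^ (j + 1) = -1 := Odd.neg_one_pow ⟨i, by omega⟩
    rw [h1] at hc
    have : (4 * kuriharaQ j + 1 : ℤ) = 3 ^ j := by exact_mod_cast hk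
    omega
  · have hj : ¬ j % 2 = 0 := by omega
    rw [if_neg hj] at hk
    have h1 : (-1 : ℤ) ^ (j + 1) = 1 := Even.neg_one_pow ⟨i + 1, by omega⟩
    rw [h1] at hc
    have : (4 * kuriharaQ j + 3 : ℤ) = 3 ^ j := by exact_mod_cast hk
    omega

/-- `Q⁺(n) = Q⁻(n) + [n even]` (`n ≥ 1`): the even top component pays one extra step (the trivial character's level). -/
theorem kobQplus_eq_kobQminus_add (n : ℕ) (hn : 1 ≤ n) :
    kobQplus n = kobQminus n + (if n % 2 = 0 then 1 else 0) := by
  have hc := kobQ_closed_form n hn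
  rcases Nat.even_or_odd n with ⟨i, hi⟩ | ⟨i, hi⟩
  · have h1 : (-1 : ℤ) ^ n = 1 := Even.neg_one_pow ⟨i, hi⟩
    rw [h1] at hc; rw [if_pos (by omega)]; omega
  · have h1 : (-1 : ℤ) ^ n = -1 := Odd.neg_one_pow ⟨i, hi⟩
    rw [h1] at hc; rw [if_neg (by omega)]; omega

/-- `Q⁺(n) = kuriharaQ (n − 1) + [n even]` for every `n ≥ 1`. -/
theorem kobQplus_eq_kuriharaQ_pred_add (n : ℕ) (hn : 1 ≤ n) :
    kobQplus n = kuriharaQ (n - 1) + (if n % 2 = 0 then 1 else 0) := by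
  rw [kobQplus_eq_kobQminus_add n hn, kobQminus_eq_kuriharaQ_pred n hn]

/-- Top-projection constants of law L3 (class-blind): `−2Q⁺(n)` and `−2Q⁻(n) − 1` for `n = 1, …, 5` are
`0, −2, −4, −14, −40` and `−1, −1, −5, −13, −41`. -/
theorem topProjection_values :
    (List.map (fun n => -(2 * (kobQplus n : ℤ))) [1, 2, 3, 4, 5] = [0, -2, -4, -14, -40]) ∧
    (List.map (fun n => -(2 * (kobQminus n : ℤ)) - 1) [1, 2, 3, 4, 5] = [-1, -1, -5, -13, -41]) := by
  decide

/-- The normalisation vector `T(m, ε)` of laws L3 / L7 (memo §3′): `T(m,+) = −2Q⁺(m)`, `T(m,−) = −2Q⁻(m) − 1` for `m ≥ 1`,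
`T(0,+) = 0`, `T(0,−) = −1` (`ε = true` is the `σ₋₁`-even parity). Memo §3″: `T(n, ε)` is the position of the top
projection of the PURE twisted ball `B_n = π_n^{−(3^n−1)/2}·O_{k_n}` (no curve; `t33/ball_pos.py`, n ≤ 4). -/
def twistShift (m : ℕ) (even : Bool) : ℤ :=
  if m = 0 then (if even then 0 else -1) else (if even then -(2 * (kobQplus m : ℤ)) else -(2 * (kobQminus m : ℤ)) - 1)

/-- `T(m, ±)` for `m ≤ 5`: `0, 0, −2, −4, −14, −40` / `−1, −1, −1, −5, −13, −41`. -/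
theorem twistShift_values :
    (List.map (fun m => twistShift m true) [0, 1, 2, 3, 4, 5] = [0, 0, -2, -4, -14, -40]) ∧
    (List.map (fun m => twistShift m false) [0, 1, 2, 3, 4, 5] = [-1, -1, -1, -5, -13, -41]) := by
  decide

/-- `T(m,+) + T(m,−) = −3^{m−1}` (the two top positions average to the valuation `−1/4`, i.e. `−φ(3^m)/4` steps each) and
`T(m,+) − T(m,−) = −(−1)^m` (they are the two step-lattice neighbours of `−(3^m − 1)/6`, assigned by parity), every `m ≥ 1`
(planner's draft: `m ≤ 10` by `decide`). -/
theorem twistShift_sum_diff (m : ℕ) (hm : 1 ≤ m) :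
    twistShift m true + twistShift m false = -(3 ^ (m - 1)) ∧ twistShift m true - twistShift m false = -((-1) ^ m) := by
  have hc := kobQ_closed_form m hm
  have h0 : m ≠ 0 := by omega
  simp only [twistShift, h0, if_false, if_true, Bool.false_eq_true]
  constructor <;> omega

/-! ## §2 D-T33-1 — the local point lattice as an INTERFACE (nothing constructed; see the module docstring for why) -/

/-- **D-T33-1 (definition request; INTERFACE, nothing constructed).** The position invariants of the local point
lattice of `W/ℚ` along `k_n = ℚ₃(μ_{3^{n+1}})`: `L_n(W) := log_ω(W(k_n) ⊗ ℤ₃) ⊂ k_n` (`ω` the Néron differential of a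
minimal model; memo §1), decomposed along `k_n = ⊕_{m ≤ n, ε = ±} V_(m,ε)` (`V_(m,ε)` = the characters of conductor `3^{m+1}`
and `σ₋₁`-parity `ε`; `V_(0,+) = ℚ₃`, `V_(0,−) = √−3·ℚ₃`). Positions are in `(γ−1)`-steps (`γ = σ₄`) relative to
`e_(m,ε) ζ_{3^{m+1}}` (calibration `ν(a) = v₃((γ−1)^a e_V ζ)`, memo §1; negative = denominators):
* `posCap n m ε` = position of `L_n(W) ∩ V_(m,ε)` (the "cap"), `ε = true` the even parity;
* `posPr n m ε` = position of the projection `e_(m,ε) L_n(W)`.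
Only `m ≤ n` is meaningful. To be read under a realisation hypothesis `realL W L` ("`L` is the datum of `W` computed
as in memo §1", instrument of record `gen16/t33/loclat.py` 0632f5d2 / `koba_calib.py`); shape `LocalLatticeDatum.RealisedShape`. -/
structure LocalLatticeDatum (W : WeierstrassCurve ℚ) where
  /-- position of the cap `L_n(W) ∩ V_(m,ε)` at tower level `n`, component level `m`, parity `ε` (`true` = even). -/
  posCap : ℕ → ℕ → Bool → ℤ
  /-- position of the projection `e_(m,ε) L_n(W)`. -/
  posPr : ℕ → ℕ → Bool → ℤ

/-- The SHAPE a realisation predicate must have: every elliptic `W/ℚ` has exactly one datum. A HYPOTHESIS on `realL`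
(used as `(h : LocalLatticeDatum.RealisedShape realL)`), never asserted. [folklore] -/
def LocalLatticeDatum.RealisedShape
    (realL : ∀ (W : WeierstrassCurve ℚ) [W.IsElliptic] [W.IsGloballyMinimal], LocalLatticeDatum W → Prop) : Prop :=
  ∀ (W : WeierstrassCurve ℚ) [W.IsElliptic] [W.IsGloballyMinimal], ∃! L : LocalLatticeDatum W, realL W L

variable (realL : ∀ (W : WeierstrassCurve ℚ) [W.IsElliptic] [W.IsGloballyMinimal], LocalLatticeDatum W → Prop)

/-! ## §3 The laws (EVIDENCE-labelled `@[conjecture]` nodes over `realL`; O5b = `ClassO5 W 3 ∧ SubTprime W 3`) -/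

/-- **L1 — SIGNED CAP LAW (irr rows; conjecture, EVIDENCE).** On an O5b curve with `W[3]|G_{ℚ₃}` irreducible (`LocIrr W 3`;
memo §2: `⟺ v₃(j − 1728) ≥ 7`, 44/132 rows) the top caps are `pos(L_n ∩ V_(n,+)) = −Q⁺(n)`, `pos(L_n ∩ V_(n,−)) = −Q⁻(n)`
(`n ≥ 1`) — Kobayashi's half products, bottom level TWISTED into the even class. EVIDENCE: exact `n ≤ 4` on `3150f1`
(`0,−1,−2,−7 / 0,0,−2,−6`), class-constant on the prototype rows; P1–P3 of kit j145657. [folklore] -/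
@[conjecture] def SignedCapLawThree : Prop :=
  ∀ (W : WeierstrassCurve ℚ) [W.IsElliptic] [W.IsGloballyMinimal] (L : LocalLatticeDatum W),
    ClassO5 W 3 → SubTprime W 3 → LocIrr W 3 → realL W L →
      ∀ n, 1 ≤ n → L.posCap n n true = -(kobQplus n : ℤ) ∧ L.posCap n n false = -(kobQminus n : ℤ)

/-- **L2 — BOUNDED CAP LAW (reducible rows; conjecture, EVIDENCE).** On an O5b curve with `W[3]|G_{ℚ₃}` reducible the top caps
are BOUNDED: `+1 / −1` on the SPLIT class (`W(ℚ₃)[3] ≠ 0`, i.e. `¬ NoLocalThreeTorsionAt W 3`; KKS's exceptional case) and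
`0 / 0` on the NONSPLIT class, for `n ≥ 2`. EVIDENCE: `2 ≤ n ≤ 4` on `90a1` / `9702g1` + prototype rows; `n = 5` = prereg P3. [folklore] -/
@[conjecture] def BoundedCapLawThree : Prop :=
  ∀ (W : WeierstrassCurve ℚ) [W.IsElliptic] [W.IsGloballyMinimal] (L : LocalLatticeDatum W),
    ClassO5 W 3 → SubTprime W 3 → ¬ LocIrr W 3 → realL W L → ∀ n, 2 ≤ n →
      (¬ NoLocalThreeTorsionAt W 3 → L.posCap n n true = 1 ∧ L.posCap n n false = -1) ∧
      (NoLocalThreeTorsionAt W 3 → L.posCap n n true = 0 ∧ L.posCap n n false = 0)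

/-- **L3 — CLASS-BLIND TOP PROJECTION LAW (all O5b rows; conjecture, EVIDENCE).** `pos(e_(n,ε) L_n) = T(n, ε)`, i.e.
`−2Q⁺(n)` / `−2Q⁻(n) − 1` (`n ≥ 1`), on ALL three local classes. Memo §3″ reduces it to LEMMA A (`e_top L_n(W) = e_top B_n`,
the twisted ball) + a purely cyclotomic identity (LEMMA B) — both provable statements, not yet written. EVIDENCE: `n ≤ 4`,
all classes (`0,−2,−4,−14 / −1,−1,−5,−13`). [folklore] -/
@[conjecture] def TopProjectionLawThree : Prop :=
  ∀ (W : WeierstrassCurve ℚ) [W.IsElliptic] [W.IsGloballyMinimal] (L : LocalLatticeDatum W),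
    ClassO5 W 3 → SubTprime W 3 → realL W L → ∀ n, 1 ≤ n → ∀ ε, L.posPr n n ε = twistShift n ε

/-- **L4 — SUPPORT / SKIP-LEVEL LAW (irr rows; conjecture, EVIDENCE).** Lower components at tower level `n`: caps unchanged,
projections drop by `φ(3^m)·⌊(n−m)/2⌋` (`1 ≤ m ≤ n`) — the `a_p = 0` trace relation `Tr_{n/n−1} x_n = −x_{n−2}` read on
positions — and the bottom projections are `−⌊n/2⌋ / −⌈n/2⌉`. EVIDENCE: `n ≤ 4` on `3150f1`, every component. [folklore] -/
@[conjecture] def SkipLevelLawThree : Prop :=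
  ∀ (W : WeierstrassCurve ℚ) [W.IsElliptic] [W.IsGloballyMinimal] (L : LocalLatticeDatum W),
    ClassO5 W 3 → SubTprime W 3 → LocIrr W 3 → realL W L → ∀ n,
      (∀ m ε, 1 ≤ m → m ≤ n →
        L.posPr n m ε = L.posPr m m ε - (totientThreePow m : ℤ) * ((n - m) / 2 : ℕ) ∧ L.posCap n m ε = L.posCap m m ε) ∧
      L.posPr n 0 true = -((n / 2 : ℕ) : ℤ) ∧ L.posPr n 0 false = -(((n + 1) / 2 : ℕ) : ℤ)

/-- **L7 — TWIST TRANSPORT (irr O5b vs good supersingular; COMPARISON statement; conjecture, EVIDENCE).** For an O5b curve `W`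
with `LocIrr W 3` and ANY elliptic `E₀/ℚ` with good supersingular reduction at `3` (`3 ∣ a₃(E₀)`; the calibration used
`y² = x³ − x`, `x³ + x + 1`, `x³ − x ± 1` — ONE profile), every component (cap and projection alike) satisfies
`POS_W(m, ε) = POS_{E₀}(m, −ε) + T(m, ε)` (`m ≤ n`). The right side is governed by Kobayashi's theorem on `Ê₀(𝔪_{k_n})`, so
the irr half of R-O5-D1 becomes a TRANSPORT statement (memo §3′ (ii), §5 RIDER). EVIDENCE: found on the 8 components at
`n = 3`, the 10 components at `n = 4` predicted and all hit. `-- TODO(general form): E₀/ℤ₃ not necessarily defined over ℚ.` [folklore] -/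
@[conjecture] def LatticeTwistTransportLawThree : Prop :=
  ∀ (W E₀ : WeierstrassCurve ℚ) [W.IsElliptic] [W.IsGloballyMinimal] [E₀.IsElliptic] [E₀.IsGloballyMinimal]
    (L : LocalLatticeDatum W) (L₀ : LocalLatticeDatum E₀),
    ClassO5 W 3 → SubTprime W 3 → LocIrr W 3 → E₀.HasGoodReductionAtPrime 3 → (3 : ℤ) ∣ E₀.frobeniusTrace 3 →
    realL W L → realL E₀ L₀ → ∀ n m ε, m ≤ n →
      L.posCap n m ε = L₀.posCap n m (!ε) + twistShift m ε ∧ L.posPr n m ε = L₀.posPr n m (!ε) + twistShift m ε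

/-- **D1-fin, POSITION FORM (irr rows; conjecture, EVIDENCE).** Memo §5: D1-fin says `W(k_{n,𝔭}) ⊗ ℤ₃` is generated over
`ℤ₃[G_n]` by `x_n, x_{n−1}` with (a) `Tr_{n/n−1} x_n = −x_{n−2}` up to units, (b) `log_ω x_k` supported on the levels `≡ k (2)`
plus the bottom level, (c) top positions `v₃(e_(n,ε) log_ω x_n) = v₃(e ζ_{3^{n+1}}) − 2Q^ε(n)/φ(3^n)`; and "(a)–(c) ⇒ L1, L3, L4
for all n, and conversely L1+L3+L4 at level n are (a)–(c) at level n component-wise". The module clauses (a)(b) have no typed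
subject (D-T33-1 not constructed); THIS node is their position content = L1 ∧ L3 ∧ L4 on the irr rows, which is what
Kobayashi's §8 construction of `Col^±_n` consumes. NOT IN PRINT over the ramified tower (module docstring). [folklore] -/
@[conjecture] def DOneFinPositionLawThree : Prop :=
  ∀ (W : WeierstrassCurve ℚ) [W.IsElliptic] [W.IsGloballyMinimal] (L : LocalLatticeDatum W),
    ClassO5 W 3 → SubTprime W 3 → LocIrr W 3 → realL W L → ∀ n, 1 ≤ n →
      (L.posCap n n true = -(kobQplus n : ℤ) ∧ L.posCap n n false = -(kobQminus n : ℤ)) ∧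
      (∀ ε, L.posPr n n ε = twistShift n ε) ∧
      (∀ m ε, 1 ≤ m → m ≤ n →
        L.posPr n m ε = L.posPr m m ε - (totientThreePow m : ℤ) * ((n - m) / 2 : ℕ) ∧ L.posCap n m ε = L.posCap m m ε) ∧
      (L.posPr n 0 true = -((n / 2 : ℕ) : ℤ) ∧ L.posPr n 0 false = -(((n + 1) / 2 : ℕ) : ℤ))

variable {realL}

/-- L1 + L3 + L4 ⇒ D1-fin (position form). [folklore] -/
theorem dOneFinPositionLaw_of_laws (h1 : SignedCapLawThree realL) (h3 : TopProjectionLawThree realL)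
    (h4 : SkipLevelLawThree realL) : DOneFinPositionLawThree realL := by
  intro W _ _ L hO hT hI hL n hn
  exact ⟨h1 W L hO hT hI hL n hn, h3 W L hO hT hL n hn, (h4 W L hO hT hI hL n).1, (h4 W L hO hT hI hL n).2⟩

/-- The closed CAP profile D1-fin forces on irr rows (`1 ≤ m ≤ n`): `−Q⁺(m)` / `−Q⁻(m)`, independent of `n`. -/
def irrCapProfile (m : ℕ) (ε : Bool) : ℤ := if ε then -(kobQplus m : ℤ) else -(kobQminus m : ℤ)

/-- The closed PROJECTION profile D1-fin forces on irr rows: bottom `−⌊n/2⌋ / −⌈n/2⌉`, level `m ≥ 1`: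
`T(m, ε) − φ(3^m)·⌊(n−m)/2⌋`. -/
def irrPrProfile (n m : ℕ) (ε : Bool) : ℤ :=
  if m = 0 then (if ε then -((n / 2 : ℕ) : ℤ) else -(((n + 1) / 2 : ℕ) : ℤ))
  else twistShift m ε - (totientThreePow m : ℤ) * ((n - m) / 2 : ℕ)

/-- Under D1-fin (position form) every cap of an irr row is the closed profile (`1 ≤ m ≤ n`). [folklore] -/
theorem posCap_eq_irrCapProfile (hD : DOneFinPositionLawThree realL) {W : WeierstrassCurve ℚ} [W.IsElliptic]
    [W.IsGloballyMinimal] {L : LocalLatticeDatum W} (hO : ClassO5 W 3) (hT : SubTprime W 3) (hI : LocIrr W 3)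
    (hL : realL W L) {n m : ℕ} (hm : 1 ≤ m) (hmn : m ≤ n) (ε : Bool) : L.posCap n m ε = irrCapProfile m ε := by
  rw [((hD W L hO hT hI hL n (hm.trans hmn)).2.2.1 m ε hm hmn).2]
  have h := (hD W L hO hT hI hL m hm).1
  cases ε <;> simp [irrCapProfile, h.1, h.2]

/-- Under D1-fin (position form) every projection of an irr row is the closed profile (`m ≤ n`, `n ≥ 1`). [folklore] -/
theorem posPr_eq_irrPrProfile (hD : DOneFinPositionLawThree realL) {W : WeierstrassCurve ℚ} [W.IsElliptic]
    [W.IsGloballyMinimal] {L : LocalLatticeDatum W} (hO : ClassO5 W 3) (hT : SubTprime W 3) (hI : LocIrr W 3)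
    (hL : realL W L) {n m : ℕ} (hn : 1 ≤ n) (hmn : m ≤ n) (ε : Bool) : L.posPr n m ε = irrPrProfile n m ε := by
  have h := hD W L hO hT hI hL n hn
  rcases Nat.eq_zero_or_pos m with rfl | hm
  · cases ε <;> simp [irrPrProfile, h.2.2.2.1, h.2.2.2.2]
  · rw [(h.2.2.1 m ε hm hmn).1, (hD W L hO hT hI hL m hm).2.1 ε]
    simp [irrPrProfile, Nat.pos_iff_ne_zero.mp hm]

/-- **RECORD (EVIDENCE ⇔ laws at `n ≤ 4`).** The closed profiles reproduce the memo's exact table (§3) of the reference irr row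
`3150f1` at tower levels `n = 1, …, 4`, every component `(m, ε)`, as `cap/pr`:
`n=4: (0,+) 0/−2 (0,−) 0/−2 (1,+) 0/−2 (1,−) 0/−3 (2,+) −1/−8 (2,−) 0/−7 (3,+) −2/−4 (3,−) −2/−5 (4,+) −7/−14 (4,−) −6/−13`
(bottom caps `0/0` are data, not part of the laws, and are omitted). -/
theorem irrProfile_matches_table :
    (List.map (fun c : ℕ × ℕ × Bool => irrPrProfile c.1 c.2.1 c.2.2)
      [(1,0,true), (1,0,false), (1,1,true), (1,1,false),
       (2,0,true), (2,0,false), (2,1,true), (2,1,false), (2,2,true), (2,2,false),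
       (3,0,true), (3,0,false), (3,1,true), (3,1,false), (3,2,true), (3,2,false), (3,3,true), (3,3,false),
       (4,0,true), (4,0,false), (4,1,true), (4,1,false), (4,2,true), (4,2,false), (4,3,true), (4,3,false),
       (4,4,true), (4,4,false)]
      = [0, -1, 0, -1,  -1, -1, 0, -1, -2, -1,  -1, -2, -2, -3, -2, -1, -4, -5,
         -2, -2, -2, -3, -8, -7, -4, -5, -14, -13]) ∧
    (List.map (fun c : ℕ × Bool => irrCapProfile c.1 c.2)
      [(1,true), (1,false), (2,true), (2,false), (3,true), (3,false), (4,true), (4,false)]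
      = [0, 0, -1, 0, -2, -2, -7, -6]) := by
  decide

/-- **L7 ⇒ P1 on the irr class**: under the twist transport, two `LocIrr` O5b curves have IDENTICAL position data (compare
both with one good supersingular `E₀`) — the pre-registered class-only dependence, for the irr class, is a COROLLARY of L7. [folklore] -/
theorem posCap_eq_of_twistTransport (h7 : LatticeTwistTransportLawThree realL) {W W' E₀ : WeierstrassCurve ℚ} [W.IsElliptic]
    [W.IsGloballyMinimal] [W'.IsElliptic] [W'.IsGloballyMinimal] [E₀.IsElliptic] [E₀.IsGloballyMinimal]
    {L : LocalLatticeDatum W} {L' : LocalLatticeDatum W'} {L₀ : LocalLatticeDatum E₀}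
    (hO : ClassO5 W 3) (hT : SubTprime W 3) (hI : LocIrr W 3) (hO' : ClassO5 W' 3) (hT' : SubTprime W' 3)
    (hI' : LocIrr W' 3) (hg : E₀.HasGoodReductionAtPrime 3) (hss : (3 : ℤ) ∣ E₀.frobeniusTrace 3)
    (hL : realL W L) (hL' : realL W' L') (hL₀ : realL E₀ L₀) {n m : ℕ} (hmn : m ≤ n) (ε : Bool) :
    L.posCap n m ε = L'.posCap n m ε ∧ L.posPr n m ε = L'.posPr n m ε := by
  have h := h7 W E₀ L L₀ hO hT hI hg hss hL hL₀ n m ε hmn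
  have h' := h7 W' E₀ L' L₀ hO' hT' hI' hg hss hL' hL₀ n m ε hmn
  exact ⟨h.1.trans h'.1.symm, h.2.trans h'.2.symm⟩

end Summit.BirchSwinnertonDyer.Rank1Residual.O5
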